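import Summits.MatrixMultiplication.MatrixMultiplication.Theorems.ObstructionDescentEmptyLevelFormat
import Summits.MatrixMultiplication.MatrixMultiplication.Theorems.ObstructionDescentPropagatedParity

set_option linter.dupNamespace false

/-!
# Obstruction descent, part N — every ODD level is empty at format 2; the odd-level pair law is unconditional

`route-MatrixMultiplication-ObstructionDescent`, aside `InvariantSaturation` (stmt 32282); decomp-mm lens-3, NODE-g15.

Part M proved `3 ∈ emptyLevels 2 2` by four evaluations.  The same five-cell family decides EVERY odd level:
there is no non-zero `B₂³`-semi-invariant of weight `((k,k),(k,k),(k,k))`, degree `2k`, on `ℂ²⊗ℂ²⊗ℂ²` for `k` odd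
(`mem_emptyLevels_two_two_of_odd`; classically `ℂ[ℂ²⊗ℂ²⊗ℂ²]^{SL₂³} = ℂ[Δ]`, `deg Δ = 4`, and `2k ≢ 0 (mod 4)`).

* **The family (`evalT_family`).**  On `T(p,x,y,z) = e₁₁₁ + p e₀₀₀ + x e₁₀₀ + y e₀₁₀ + z e₀₀₁` the slice sums (part I)
  leave the monomials `x₀₀₀^{k-2β} (x₁₀₀x₀₁₀x₀₀₁)^β x₁₁₁^{k-β}`, `0 ≤ β ≤ k/2`:
  `f(T(p,x,y,z)) = Σ_β c_β p^{k-2β} (xyz)^β`.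
* **The functional equation (`family_functional_equation`).**  For `U_s = T(1,s,1,1)`, the odd corner permutation
  `(swap,swap,swap)` gives `f(V_s) = -f(U_s)` (H12 (B′), `k` odd), and the Borel shears `x₀ ↦ x₀ - s x₁ | x₀ - x₁ | x₀ - x₁`
  (trivial character) carry `V_s` to `T(1+2s, -1, -s, -s)`.  Hence, identically in `s`,
  `Σ_β c_β (1+2s)^{k-2β} (-s²)^β = - Σ_β c_β s^β`.
* **Triangularity (`family_coeff_eq_zero`).**  Comparing the coefficient of `s^n`: the `β`-th summand on the left is
  divisible by `s^{2β}`, so only `β ≤ n/2` contribute there; by induction on `n` all `c_β` with `β < n` vanish except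
  possibly… none: at `n = 0` one gets `2c₀ = 0`, and at `n ≥ 1` exactly `c_n = 0`.  So `f` vanishes on the family, and
  — by the Gaussian elimination and the line through `e₁₁₁` of part M — everywhere.

CONSEQUENCES (parts K, L): for every odd `k` and every format `m ≥ 2`, `k ∈ emptyLevels m 2`
(`mem_emptyLevels_two_of_odd`) and THE ODD-LEVEL PAIR LAW holds unconditionally (`evalT_eq_zero_of_odd_level`,
`not_mem_pointLevels_of_odd_level`): every level-`k` weight vector of the full type `((k^m))³` vanishes on all tensors
of rank `≤ r` whenever `(k-1)(r-1) < k(m-1)`.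

[cite: BurgisserIkenmeyer2011, §3.1–3.2 and §6.2], [cite: BurgisserIkenmeyer2017, §5 (5.2), Thm 5.3],
[cite: LandsbergGCT2017, §8.3.4].
-/

noncomputable section

open scoped BigOperators
open Finset

namespace Summit.MatrixMultiplication.MatrixMultiplication.Theorems.ObstructionCalculus

open Literature.Computability.AlgebraicComplexity (actTensor actTensor_apply actTensor_permMatrix_apply tensorRank)

section OddLevelFormatTwo

variable {k : ℕ}

/-- **The five-cell family at level `k`.**  For a weight vector `f` of type `((k,k),(k,k),(k,k))`, degree `2k`, on
`ℂ²⊗ℂ²⊗ℂ²`: `f(e₁₁₁ + p e₀₀₀ + x e₁₀₀ + y e₀₁₀ + z e₀₀₁) = Σ_{β ≤ k/2} c_β p^{k-2β}(xyz)^β`, `c_β` the coefficient of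
`x₀₀₀^{k-2β}(x₁₀₀x₀₁₀x₀₀₁)^β x₁₁₁^{k-β}`. [this node] -/
theorem evalT_family {f : MvPolynomial (Idx 2) ℂ} (hf : f ∈ hwvSpace (rectType 2 2 k) (k * 2)) (p x y z : ℂ) :
    evalT (fun a b c => ![![![p, z], ![y, 0]], ![![x, 0], ![0, 1]]] a b c) f =
      ∑ β ∈ Finset.range (k / 2 + 1), f.coeff (Finsupp.equivFunOnFinite.symm fun q : Idx 2 =>
        ![![![k - 2 * β, β], ![β, 0]], ![![β, 0], ![0, k - β]]] q.1 q.2.1 q.2.2) * (p ^ (k - 2 * β) * (x * y * z) ^ β) := by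
  classical
  set ν : ℕ → (Idx 2 →₀ ℕ) := fun β => Finsupp.equivFunOnFinite.symm fun q : Idx 2 =>
    ![![![k - 2 * β, β], ![β, 0]], ![![β, 0], ![0, k - β]]] q.1 q.2.1 q.2.2 with hν
  have hνv : ∀ (β : ℕ) (q : Idx 2), ν β q = ![![![k - 2 * β, β], ![β, 0]], ![![β, 0], ![0, k - β]]] q.1 q.2.1 q.2.2 :=
    fun β q => by simp [hν]
  -- (1) classification of the live monomials
  have hcls : ∀ μ ∈ f.support, μ (0, 1, 1) = 0 → μ (1, 0, 1) = 0 → μ (1, 1, 0) = 0 →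
      2 * μ (1, 0, 0) ≤ k ∧ ν (μ (1, 0, 0)) = μ := by
    intro μ hμ h011 h101 h110
    have hext : ∀ (P : Idx 2 → Prop) [DecidablePred P],
        (∑ q ∈ μ.support.filter P, μ q) = ∑ q ∈ (Finset.univ : Finset (Idx 2)).filter P, μ q := by
      intro P _
      apply Finset.sum_subset (Finset.filter_subset_filter P (Finset.subset_univ _))
      intro q hq hq'
      rw [Finset.mem_filter] at hq hq'
      exact Finsupp.notMem_support_iff.mp fun h => hq' ⟨h, hq.2⟩
    obtain ⟨h00, h10, h20⟩ := sliceSum_eq_of_mem_support hf hμ 0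
    obtain ⟨h01, h11, h21⟩ := sliceSum_eq_of_mem_support hf hμ 1
    rw [hext, rectType_self_apply] at h00 h10 h20 h01 h11 h21
    simp only [Finset.sum_filter, Fintype.sum_prod_type, Fin.sum_univ_two, Fin.isValue, if_true,
      Fin.zero_eq_one_iff, OfNat.ofNat_ne_one, one_ne_zero, if_false, add_zero,
      zero_add] at h00 h10 h20 h01 h11 h21
    refine ⟨by omega, ?_⟩
    ext ⟨a, b, c⟩
    rw [hνv]
    fin_cases a <;> fin_cases b <;> fin_cases c <;> simp [h011, h101, h110] <;> omega
  -- (2) expansion of the evaluation: dead monomials contribute nothing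
  rw [evalT, MvPolynomial.aeval_eq_eval, MvPolynomial.eval_eq',
    ← Finset.sum_filter_add_sum_filter_not f.support
      (fun μ : Idx 2 →₀ ℕ => μ (0, 1, 1) = 0 ∧ μ (1, 0, 1) = 0 ∧ μ (1, 1, 0) = 0)]
  have hdead : ∑ μ ∈ f.support.filter (fun μ : Idx 2 →₀ ℕ => ¬ (μ (0, 1, 1) = 0 ∧ μ (1, 0, 1) = 0 ∧ μ (1, 1, 0) = 0)),
      f.coeff μ * ∏ q : Idx 2, (fun q : Idx 2 => ![![![p, z], ![y, 0]], ![![x, 0], ![0, 1]]] q.1 q.2.1 q.2.2) q ^ μ q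
        = 0 := by
    refine Finset.sum_eq_zero fun μ hμ => ?_
    obtain ⟨-, h0⟩ := Finset.mem_filter.mp hμ
    apply mul_eq_zero_of_right
    simp only [not_and_or] at h0
    rcases h0 with h | h | h
    · exact Finset.prod_eq_zero (Finset.mem_univ ((0 : Fin 2), (1 : Fin 2), (1 : Fin 2))) (by simp [zero_pow h])
    · exact Finset.prod_eq_zero (Finset.mem_univ ((1 : Fin 2), (0 : Fin 2), (1 : Fin 2))) (by simp [zero_pow h])
    · exact Finset.prod_eq_zero (Finset.mem_univ ((1 : Fin 2), (1 : Fin 2), (0 : Fin 2))) (by simp [zero_pow h])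
  rw [hdead, add_zero]
  -- (3) live monomials ↔ `β ≤ k/2` with `ν β ∈ supp f`
  symm
  rw [← Finset.sum_filter_of_ne (p := fun β => ν β ∈ f.support) (fun β _ hne => by
    by_contra h
    exact hne (by rw [MvPolynomial.notMem_support_iff.mp h, zero_mul]))]
  refine Finset.sum_nbij' (fun β => ν β) (fun μ => μ (1, 0, 0)) (fun β hβ => ?_) (fun μ hμ => ?_) (fun β _ => ?_)
    (fun μ hμ => ?_) (fun β _ => ?_)
  · obtain ⟨-, hs⟩ := Finset.mem_filter.mp hβ
    exact Finset.mem_filter.mpr ⟨hs, by simp [hνv]⟩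
  · obtain ⟨hs, h1, h2, h3⟩ := Finset.mem_filter.mp hμ
    obtain ⟨hle, heq⟩ := hcls μ hs h1 h2 h3
    refine Finset.mem_filter.mpr ⟨Finset.mem_range.mpr (by omega), ?_⟩
    simp only [heq]
    exact hs
  · simp [hνv]
  · obtain ⟨hs, h1, h2, h3⟩ := Finset.mem_filter.mp hμ
    exact (hcls μ hs h1 h2 h3).2
  · congr 1
    simp only [Fintype.prod_prod_type, Fin.prod_univ_two, hνv]
    simp
    ring

/-- **The functional equation of the family coefficients** (`k` odd): identically in `s`,
`Σ_β c_β (1+2s)^{k-2β}(-s²)^β = -Σ_β c_β s^β` — from the sign law for `(swap,swap,swap)` (H12 (B′)) and three Borel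
shears carrying `(swap,swap,swap)·T(1,s,1,1)` to `T(1+2s,-1,-s,-s)`. [this node] -/
theorem family_functional_equation (hk : Odd k) {f : MvPolynomial (Idx 2) ℂ}
    (hf : f ∈ hwvSpace (rectType 2 2 k) (k * 2)) (s : ℂ) :
    ∑ β ∈ Finset.range (k / 2 + 1), f.coeff (Finsupp.equivFunOnFinite.symm fun q : Idx 2 =>
        ![![![k - 2 * β, β], ![β, 0]], ![![β, 0], ![0, k - β]]] q.1 q.2.1 q.2.2) *
          ((1 + 2 * s) ^ (k - 2 * β) * ((-1) * (-s) * (-s)) ^ β) =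
      -∑ β ∈ Finset.range (k / 2 + 1), f.coeff (Finsupp.equivFunOnFinite.symm fun q : Idx 2 =>
        ![![![k - 2 * β, β], ![β, 0]], ![![β, 0], ![0, k - β]]] q.1 q.2.1 q.2.2) * (1 ^ (k - 2 * β) * (s * 1 * 1) ^ β) := by
  classical
  set σ : Equiv.Perm (Fin 2) := Equiv.swap 0 1 with hσ
  have hσm : ∀ a : Fin 2, σ a ≠ a → 2 ≤ (a : ℕ) + 2 := fun a _ => by omega
  have hsign : Equiv.Perm.sign σ = -1 := Equiv.Perm.sign_swap (by decide)
  set A : Matrix (Fin 2) (Fin 2) ℂ := !![1, -s; 0, 1] with hA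
  set S : Matrix (Fin 2) (Fin 2) ℂ := !![1, -1; 0, 1] with hS
  have hAb : A ∈ borel 2 := by
    refine ⟨fun i j hji => ?_, fun i => ?_⟩
    · fin_cases i <;> fin_cases j <;> simp [hA] at hji ⊢
    · fin_cases i <;> simp [hA]
  have hSb : S ∈ borel 2 := by
    refine ⟨fun i j hji => ?_, fun i => ?_⟩
    · fin_cases i <;> fin_cases j <;> simp [hS] at hji ⊢
    · fin_cases i <;> simp [hS]
  have hwA : weightChar (rectType 2 2 k 0) A = 1 := by simp [weightChar, Fin.prod_univ_two, hA]
  have hwS : ∀ i : Fin 3, weightChar (rectType 2 2 k i) S = 1 := fun i => by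
    simp [weightChar, Fin.prod_univ_two, hS]
  have hU := evalT_family hf 1 s 1 1
  have hV := evalT_actTensor_permMatrix_of_odd hk hf σ hσm hsign
    (fun a b c => ![![![(1 : ℂ), 1], ![1, 0]], ![![s, 0], ![0, 1]]] a b c)
  have hVe : actTensor (σ.permMatrix ℂ) (σ.permMatrix ℂ) (σ.permMatrix ℂ)
      (fun a b c => ![![![(1 : ℂ), 1], ![1, 0]], ![![s, 0], ![0, 1]]] a b c) =
      fun a b c => ![![![(1 : ℂ), 0], ![0, s]], ![![0, 1], ![1, 1]]] a b c := by
    funext a b c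
    rw [actTensor_permMatrix_apply]
    fin_cases a <;> fin_cases b <;> fin_cases c <;> simp [hσ]
  have hW := hf.2 A S S hAb hSb hSb (fun a b c => ![![![(1 : ℂ), 0], ![0, s]], ![![0, 1], ![1, 1]]] a b c)
  have hWe : actTensor A S S (fun a b c => ![![![(1 : ℂ), 0], ![0, s]], ![![0, 1], ![1, 1]]] a b c) =
      fun a b c => ![![![1 + 2 * s, -s], ![-s, 0]], ![![-1, 0], ![0, 1]]] a b c := by
    funext a b c
    simp only [actTensor_apply, Fin.sum_univ_two, hA, hS]
    fin_cases a <;> fin_cases b <;> fin_cases c <;> simp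
    all_goals ring
  have hT := evalT_family hf (1 + 2 * s) (-1) (-s) (-s)
  rw [hVe] at hV
  rw [hWe, hwA, hwS 1, hwS 2, one_mul, one_mul, one_mul, hT, hV, hU] at hW
  exact hW

/-- **Triangularity: all family coefficients vanish** (`k` odd). [this node] -/
theorem family_coeff_eq_zero (hk : Odd k) {f : MvPolynomial (Idx 2) ℂ} (hf : f ∈ hwvSpace (rectType 2 2 k) (k * 2))
    {β : ℕ} (hβ : β < k / 2 + 1) :
    f.coeff (Finsupp.equivFunOnFinite.symm fun q : Idx 2 =>
      ![![![k - 2 * β, β], ![β, 0]], ![![β, 0], ![0, k - β]]] q.1 q.2.1 q.2.2) = 0 := by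
  classical
  set c : ℕ → ℂ := fun β => f.coeff (Finsupp.equivFunOnFinite.symm fun q : Idx 2 =>
    ![![![k - 2 * β, β], ![β, 0]], ![![β, 0], ![0, k - β]]] q.1 q.2.1 q.2.2) with hc
  -- the polynomial identity `L + R = 0`
  set L : Polynomial ℂ := ∑ β ∈ Finset.range (k / 2 + 1), Polynomial.C (c β) * Polynomial.X ^ β with hL
  set R : Polynomial ℂ := ∑ β ∈ Finset.range (k / 2 + 1),
    Polynomial.C (c β * (-1) ^ β) * (1 + Polynomial.C 2 * Polynomial.X) ^ (k - 2 * β) * Polynomial.X ^ (2 * β) with hR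
  have hLR : L + R = 0 := by
    apply Polynomial.funext
    intro s
    have h := family_functional_equation hk hf s
    rw [Polynomial.eval_add, Polynomial.eval_zero, hL, hR, Polynomial.eval_finsetSum, Polynomial.eval_finsetSum]
    have h1 : ∀ β ∈ Finset.range (k / 2 + 1),
        Polynomial.eval s (Polynomial.C (c β * (-1) ^ β) * (1 + Polynomial.C 2 * Polynomial.X) ^ (k - 2 * β) *
          Polynomial.X ^ (2 * β)) = c β * ((1 + 2 * s) ^ (k - 2 * β) * ((-1) * (-s) * (-s)) ^ β) := by
      intro β _
      simp only [Polynomial.eval_mul, Polynomial.eval_C, Polynomial.eval_pow, Polynomial.eval_add,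
        Polynomial.eval_one, Polynomial.eval_X]
      rw [show ((-1 : ℂ) * -s * -s) = (-1) * s ^ 2 by ring, mul_pow, pow_mul]
      ring
    have h2 : ∀ β ∈ Finset.range (k / 2 + 1), Polynomial.eval s (Polynomial.C (c β) * Polynomial.X ^ β) =
        c β * (1 ^ (k - 2 * β) * (s * 1 * 1) ^ β) := by
      intro β _
      simp only [Polynomial.eval_mul, Polynomial.eval_C, Polynomial.eval_pow, Polynomial.eval_X, one_pow, mul_one,
        one_mul]
    rw [Finset.sum_congr rfl h1, Finset.sum_congr rfl h2, h]
    ring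
  -- coefficient extraction, by strong induction on `β`
  induction β using Nat.strong_induction_on with
  | _ n ih =>
    show c n = 0
    have hih : ∀ m < n, m < k / 2 + 1 → c m = 0 := fun m hm hm' => ih m hm hm'
    have hcoef := congrArg (fun P : Polynomial ℂ => P.coeff n) hLR
    simp only [Polynomial.coeff_add, Polynomial.coeff_zero, hL, hR, Polynomial.finsetSum_coeff,
      Polynomial.coeff_C_mul_X_pow] at hcoef
    rw [Finset.sum_ite_eq, if_pos (Finset.mem_range.mpr hβ)] at hcoef
    -- the `R`-part: only `β` with `2β ≤ n` contribute, and those have `β < n` (or `β = n = 0`)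
    have hRn : ∑ β ∈ Finset.range (k / 2 + 1), (Polynomial.C (c β * (-1) ^ β) *
        (1 + Polynomial.C 2 * Polynomial.X) ^ (k - 2 * β) * Polynomial.X ^ (2 * β)).coeff n =
          if n = 0 then c 0 else 0 := by
      rw [Finset.sum_eq_single 0]
      · simp only [pow_zero, mul_one, mul_zero, Nat.sub_zero]
        rw [Polynomial.coeff_C_mul]
        split_ifs with hn
        · subst hn
          rw [Polynomial.coeff_zero_eq_eval_zero]
          simp
        · rw [hih 0 (Nat.pos_of_ne_zero hn) (by omega), zero_mul]
      · intro β hβr hβ0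
        rw [Polynomial.coeff_mul_X_pow']
        split_ifs with hle
        · have hβn : β < n := by omega
          rw [Polynomial.coeff_C_mul, hih β hβn (Finset.mem_range.mp hβr), zero_mul, zero_mul]
        · rfl
      · intro h
        exact absurd (Finset.mem_range.mpr (Nat.succ_pos _)) h
    rw [hRn] at hcoef
    split_ifs at hcoef with hn
    · subst hn
      have h2 : (2 : ℂ) * c 0 = 0 := by rw [two_mul]; exact hcoef
      exact (mul_eq_zero.mp h2).resolve_left two_ne_zero
    · rw [add_zero] at hcoef
      exact hcoef

/-- **Every odd level is empty at format 2:** `k ∈ emptyLevels 2 2` for `k` odd (`g((k,k),(k,k),(k,k)) = 0`).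
[this node] -/
theorem mem_emptyLevels_two_two_of_odd (hk : Odd k) : k ∈ emptyLevels 2 2 := by
  classical
  show hwvSpace (rectType 2 2 k) (k * 2) = ⊥
  rw [Submodule.eq_bot_iff]
  intro f hf
  -- `f` vanishes on the family
  have hfam : ∀ p x y z : ℂ, evalT (fun a b c => ![![![p, z], ![y, 0]], ![![x, 0], ![0, 1]]] a b c) f = 0 := by
    intro p x y z
    rw [evalT_family hf]
    exact Finset.sum_eq_zero fun β hβ => by rw [family_coeff_eq_zero hk hf (Finset.mem_range.mp hβ), zero_mul]
  -- every tensor with `t₁₁₁ ≠ 0` is carried into the family by a Borel triple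
  have hmain : ∀ t : Tensor ℂ 2, t 1 1 1 ≠ 0 → evalT t f = 0 := by
    intro t ht
    set A : Matrix (Fin 2) (Fin 2) ℂ := !![1, -(t 0 1 1) / t 1 1 1; 0, (t 1 1 1)⁻¹] with hAd
    set B : Matrix (Fin 2) (Fin 2) ℂ := !![1, -(t 1 0 1) / t 1 1 1; 0, 1] with hBd
    set C : Matrix (Fin 2) (Fin 2) ℂ := !![1, -(t 1 1 0) / t 1 1 1; 0, 1] with hCd
    have hAb : A ∈ borel 2 := by
      refine ⟨fun i j hji => ?_, fun i => ?_⟩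
      · fin_cases i <;> fin_cases j <;> simp [hAd] at hji ⊢
      · fin_cases i <;> simp [hAd, ht]
    have hBb : B ∈ borel 2 := by
      refine ⟨fun i j hji => ?_, fun i => ?_⟩
      · fin_cases i <;> fin_cases j <;> simp [hBd] at hji ⊢
      · fin_cases i <;> simp [hBd]
    have hCb : C ∈ borel 2 := by
      refine ⟨fun i j hji => ?_, fun i => ?_⟩
      · fin_cases i <;> fin_cases j <;> simp [hCd] at hji ⊢
      · fin_cases i <;> simp [hCd]
    have key := hf.2 A B C hAb hBb hCb t
    have hform : actTensor A B C t = fun a b c =>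
        ![![![actTensor A B C t 0 0 0, actTensor A B C t 0 0 1], ![actTensor A B C t 0 1 0, 0]],
          ![![actTensor A B C t 1 0 0, 0], ![0, 1]]] a b c := by
      funext a b c
      fin_cases a <;> fin_cases b <;> fin_cases c
      · simp
      · simp
      · simp
      · simp [actTensor_apply, Fin.sum_univ_two, hAd, hBd, hCd]
        field_simp
        ring
      · simp
      · simp [actTensor_apply, Fin.sum_univ_two, hAd, hBd, hCd]
        field_simp
        ring
      · simp [actTensor_apply, Fin.sum_univ_two, hAd, hBd, hCd]
        field_simp
        ring
      · simp [actTensor_apply, Fin.sum_univ_two, hAd, hBd, hCd, ht]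
    rw [hform, hfam] at key
    exact (mul_eq_zero.mp key.symm).resolve_left
      (mul_ne_zero (mul_ne_zero (weightChar_ne_zero _ hAb) (weightChar_ne_zero _ hBb)) (weightChar_ne_zero _ hCb))
  -- every tensor, by the line through `e₁₁₁`
  have hall : ∀ t : Tensor ℂ 2, evalT t f = 0 := by
    intro t
    obtain ⟨Q, hQ⟩ := exists_polynomial_evalT_line f t (fun a b c => if a = 1 ∧ b = 1 ∧ c = 1 then (1 : ℂ) else 0)
    have hroot : ({-t 1 1 1}ᶜ : Set ℂ) ⊆ {u | Q.IsRoot u} := by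
      intro u hu
      rw [Set.mem_compl_singleton_iff] at hu
      rw [Set.mem_setOf_eq, Polynomial.IsRoot.def, ← hQ]
      apply hmain
      simp only [Pi.add_apply, Pi.smul_apply, smul_eq_mul, and_self, if_true, mul_one]
      intro h
      exact hu (by linear_combination h)
    have hQ0 : Q = 0 :=
      Polynomial.eq_zero_of_infinite_isRoot Q (((Set.finite_singleton (-t 1 1 1)).infinite_compl).mono hroot)
    have h0 := hQ 0
    rwa [zero_smul, add_zero, hQ0, Polynomial.eval_zero] at h0
  apply MvPolynomial.funext
  intro v
  have h := hall fun a b c => v (a, b, c)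
  rw [evalT, MvPolynomial.aeval_eq_eval] at h
  rw [map_zero]
  simpa only [Prod.mk.eta] using h

/-- **Odd levels are empty at block format 2 for every ambient format `m ≥ 2`** (part L). [this node] -/
theorem mem_emptyLevels_two_of_odd (hk : Odd k) {m : ℕ} (hm : 2 ≤ m) : k ∈ emptyLevels m 2 :=
  (mem_emptyLevels_iff_self hm).mpr (mem_emptyLevels_two_two_of_odd hk)

/-- **THE ODD-LEVEL PAIR LAW, unconditional.**  For `k` odd and every format `m ≥ 2`, every level-`k` weight vector of
the full type `((k^m))³` (degree `km`) vanishes on all tensors of rank `≤ r` whenever `(k-1)(r-1) < k(m-1)`.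
[this node] -/
theorem evalT_eq_zero_of_odd_level (hk : Odd k) {m : ℕ} (hm : 2 ≤ m) {f : MvPolynomial (Idx m) ℂ}
    (hf : f ∈ hwvSpace (rectType m m k) (k * m)) {r : ℕ} (hr : (k - 1) * (r - 1) < k * (m - 1)) {t : Tensor ℂ m}
    (ht : tensorRank t ≤ r) : evalT t f = 0 :=
  evalT_eq_zero_of_emptyLevel_two_two (mem_emptyLevels_two_two_of_odd hk) hm hf hr ht

/-- The same in level language: `k ∉ E′_m(t)` for `k` odd, `R(t) ≤ r`, `(k-1)(r-1) < k(m-1)`. [this node] -/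
theorem not_mem_pointLevels_of_odd_level (hk : Odd k) {m : ℕ} (hm : 2 ≤ m) {r : ℕ}
    (hr : (k - 1) * (r - 1) < k * (m - 1)) {t : Tensor ℂ m} (ht : tensorRank t ≤ r) : k ∉ pointLevels m t :=
  not_mem_pointLevels_of_emptyLevel_two_two (mem_emptyLevels_two_two_of_odd hk) hm hr ht

end OddLevelFormatTwo

end Summit.MatrixMultiplication.MatrixMultiplication.Theorems.ObstructionCalculus

end
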